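import Mathlib.Tactic.Linarith
import Mathlib.Tactic.Ring
import Mathlib.Tactic.NormNum
import Mathlib.Algebra.Order.BigOperators.Group.Finset
import Mathlib.Data.Fintype.BigOperators
import Mathlib.Logic.Function.Basic
import Mathlib.Tactic.FinCases
import HarnessLib

/-!
# The (0,1) cell of the ι-window, EXISTENCE side, XXVI: theta-biduality of the nodal carrier and the four theta-translates through the
# nodal Beauville–Debarre residual — skeleton of `H2-EXISTENCE-SIDE-26.md` (prover 3 gen 33)

Family `hodge`, b2b cell `hweil`, `Summits/HodgeConjecture/HodgeConjecture/Theorems` (helper of item stmt-HodgeConjecture-2524). New topic, new file.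

Setting and notation as in [XVI]–[XXV]: `(A, Θ)` a general ppav fourfold (`NS = ℤθ`, `Θ` smooth, symmetric; simple; not a Jacobian),
`γ = θ³/6`; `A ≅ P(C̃/C)` the Prym of a double cover `π : C̃ → C` of a genus-4 curve ramified at two points (`g(C̃) = 8`), nodal
Abel–Prym carrier `Z_n = ψ(C̃)`, theta-dual `Z* = T(Z_n) = {x : Z_n ⊂ Θ_x}` (the Prym–Brill–Noether curve, smooth irreducible of degree 8
and genus 9 by [XXV]), `V(Y) = {x : Y ⊂ Θ_x}`, `X(u,w) = Θ ∩ Θ_u ∩ Θ_{−w} = Z* + R` with `R = S_{pq}` Beauville's special curve of the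
pencil `|K_C − p̄ − q̄|`.
The report proves: (W) `Z*` has class `2γ` and, by WELTERS' theorem on curves of twice the minimal class (Indag. Math. 49 (1987), Thm.
(3.1)), is a translate of the Abel–Prym curve of an ÉTALE double cover `N = Z* → N₀` of a smooth genus-5 curve with `(A, Θ) ≅ P(N/N₀)`;
(BD) THETA-BIDUALITY `V(Z*) = T(T(Z_n)) = Z_n` with multiplicity one (via the étale theta-dual `T(AP curve) = V²`, pure of dimension 1 and
class `2γ`, and the degree bound `≥ 5` for every curve in `A`); hence `kdim = 2` holds for EVERY nodal half-pair, `V(D′) = Z_n + a′`, and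
the nodal carrier is a (nodal) Prym–Brill–Noether curve `V²` of the étale presentation and a limit of étale carriers, so every pair on it
is bitangent; (VR) `V(R) = {0, u, −w, u − w}` and `V(C′) = {±a, ±a′}` EXACTLY, by reduction to 'a non-effective `L ∈ Pic²(C̃)` cannot
have `L(D₁)` effective for all divisors `D₁` of the polygonal curve' and an EIGHT-POINT LEMMA in `ℙ⁴` combined with the Brill–Noether
generality of `C̃`.
HONEST FRAMING: this file records the steps that are genuinely finite — Welters' genus spectrum at `g = 4`, the class arithmetic, the
degree budget that forces `V(Z*) = Z_n` with multiplicity one, the divisor-coincidence exclusion behind 'every pair', the hypercube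
propagation step of the eight-point lemma, the Riemann–Roch / Brill–Noether numbers of (VR), and the count of the four theta-translates.
The geometry (Pryms, theta-duals, Welters' classification, Brill–Noether theory) is NOT kernel-checked; census results about one cell of
the ladder's H2 test on the existence side; no case of the Hodge conjecture is proved; nothing here is a rung; no statement of
[Markman 2025] is used. 0 unconditional rungs above the floor.
-/

set_option linter.dupNamespace false

namespace Summit.HodgeConjecture.HodgeConjecture.WeilTypeLadder

section H2ThetaBidualityXXVI

open Finset

/-- WELTERS' GENUS SPECTRUM AT `g = 4` (report 2.3; Welters 1987 Thm. (3.1) with (2.4), (2.7), (2.15)): an irreducible curve of class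
`2z` on a ppav of dimension `g` has normalisation of genus `g` (Case I), `2g − 1` (Case II⁻), or `2g + 1 − δ/2` (Case II⁺, `δ = 2·dh`
the number of fixed points of the involution, `dh ≤ g + 1`). A SMOOTH such curve of genus `9` on a fourfold is therefore in Case II⁺
with `δ = 0`: an ÉTALE double cover of a curve of genus `g + 1 − δ/2 = 5`; and the nodal carrier is the case `δ = 2`, genus `8`,
arithmetic genus `8 + 1 = 9`. -/
theorem welters_spectrum_genus_nine (g : ℕ) (hg : g = 4) :
    (9 ≠ g ∧ 9 ≠ 2 * g - 1) ∧
    (∀ dh : ℕ, dh ≤ g + 1 → 2 * g + 1 - dh = 9 → dh = 0 ∧ g + 1 - dh = 5 ∧ 2 * 5 - 1 = 9) ∧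
    (2 * g + 1 - 1 = 8 ∧ 8 + 1 = 9 ∧ g + 1 - 1 = 4) := by
  subst hg
  refine ⟨by norm_num, fun dh _ h => ?_, by norm_num⟩
  omega

/-- THE CLASS ARITHMETIC (report 2.2, LEMMA CL): on a Hodge-general ppav fourfold every Hodge class of degree 6 is `q·θ³`; with
`θ⁴ = 24` and `θ·Z* = 8` this gives `q = 1/3`, i.e. `[Z*] = θ³/3 = 2·(θ³/6) = 2γ` (degree `2·4 = 8`), and the residual `R` of the
complete intersection `θ³` has class `θ³ − θ³/3 = 4·(θ³/6) = 4γ` (degree 16). -/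
theorem class_two_gamma_arith (q : ℚ) (hq : 24 * q = 8) :
    q = 1 / 3 ∧ q = 2 * (1 / 6) ∧ (2 : ℚ) * (24 / 6) = 8 ∧ (1 : ℚ) - q = 4 * (1 / 6) ∧ (4 : ℚ) * (24 / 6) = 16 := by
  have hq' : q = 1 / 3 := by linarith
  subst hq'
  norm_num

/-- THE DEGREE BUDGET OF THETA-BIDUALITY (report 3.2, LOAD-BEARING for THEOREM BD): `V(Z*)` is a translate of the Prym–Brill–Noether
curve `V²` of an étale presentation, PURE of dimension one with cycle class `2γ`: its components `V_i` have multiplicities `m_i ≥ 1` and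
`Θ`-degrees `d_i ≥ 5` (every curve in the simple non-Jacobian fourfold has degree `≥ 5`, [XXV] LEMMA MR) with `Σ m_i d_i = θ·2γ = 8`;
it contains the irreducible nodal carrier `Z_n` (index `i₀`). CONCLUSION: `V(Z*)` has exactly ONE component, of multiplicity one and
degree 8 — `V(Z*) = Z_n` and `θ·Z_n = 8`. -/
theorem biduality_degree_budget {ι : Type*} [Fintype ι] (m d : ι → ℕ) (i₀ : ι)
    (hm : ∀ i, 1 ≤ m i) (hd : ∀ i, 5 ≤ d i) (h : ∑ i, m i * d i = 8) :
    Fintype.card ι = 1 ∧ m i₀ = 1 ∧ d i₀ = 8 := by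
  have h1 : ∀ i, 5 ≤ m i * d i := fun i => by
    have := Nat.mul_le_mul (hm i) (hd i)
    simpa using this
  have h2 : Fintype.card ι * 5 ≤ ∑ i, m i * d i := by
    have := Finset.card_nsmul_le_sum (Finset.univ : Finset ι) (fun i => m i * d i) 5 (fun i _ => h1 i)
    simpa using this
  have hpos : 0 < Fintype.card ι := Fintype.card_pos_iff.mpr ⟨i₀⟩
  have hcard : Fintype.card ι = 1 := by omega
  -- with one index, the sum is the single term
  have hsingle : ∑ i, m i * d i = m i₀ * d i₀ := by
    have huniv : (Finset.univ : Finset ι) = {i₀} := by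
      symm
      apply Finset.eq_univ_of_card
      rw [Finset.card_singleton, hcard]
    rw [huniv, Finset.sum_singleton]
  rw [hsingle] at h
  refine ⟨hcard, ?_, ?_⟩
  · by_contra hc
    have h2m : 2 ≤ m i₀ := by have := hm i₀; omega
    have : 10 ≤ m i₀ * d i₀ := by
      have := Nat.mul_le_mul h2m (hd i₀)
      simpa using this
    omega
  · have hm1 : m i₀ = 1 := by
      by_contra hc
      have h2m : 2 ≤ m i₀ := by have := hm i₀; omega
      have : 10 ≤ m i₀ * d i₀ := by
        have := Nat.mul_le_mul h2m (hd i₀)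
        simpa using this
      omega
    rw [hm1, Nat.one_mul] at h
    exact h

/-- 'EVERY PAIR' (report 3.3, COR BD1): for `u = ψ(x)`, `w = ψ(σy)` on the nodal carrier, `u ± w ∈ Z_n = ψ(C̃)` would give a linear
equivalence `x + σy + σr ∼ σx + y + r` of effective degree-3 divisors; on a curve without `g¹₃` they must be EQUAL as divisors. The
genuinely finite step: if `σ` is an involution, `x, y` are not fixed by `σ` and `y ∉ {x, σx}` (the pair `(u, w)` is non-degenerate:
`u, w ≠ 0`, `w ≠ ±u`), then the degree-3 divisors `x + σy + σr` and `σx + y + r` (multisets) are NEVER equal, whatever `r` is. -/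
theorem no_divisor_coincidence {α : Type*} [DecidableEq α] (σ : α → α) (hσ : ∀ z, σ (σ z) = z)
    (x y r : α) (hx : σ x ≠ x) (hy : σ y ≠ y) (hxy : y ≠ x) (hxy' : y ≠ σ x) :
    ({x, σ y, σ r} : Multiset α) ≠ {σ x, y, r} := by
  intro h
  -- y lies in the right-hand side, hence in the left-hand side: y = x, y = σ y or y = σ r
  have hy_mem : y ∈ ({x, σ y, σ r} : Multiset α) := by
    rw [h]; simp
  simp only [Multiset.insert_eq_cons, Multiset.mem_cons, Multiset.mem_singleton] at hy_mem
  rcases hy_mem with h1 | h1 | h1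
  · exact hxy h1
  · exact hy h1.symm
  · -- so r = σ y; then x lies in {σ x, y, σ y}
    have hr : r = σ y := by rw [h1, hσ]
    subst hr
    have hx_mem : x ∈ ({σ x, y, σ y} : Multiset α) := by
      rw [← h]; simp
    simp only [Multiset.insert_eq_cons, Multiset.mem_cons, Multiset.mem_singleton] at hx_mem
    rcases hx_mem with h2 | h2 | h2
    · exact hx h2.symm
    · exact hxy h2.symm
    · apply hxy'
      rw [h2, hσ]

/-- THE HYPERCUBE PROPAGATION STEP of the eight-point lemma (report 4.3, Case A): the 16 transversal quadruples are the vertices of the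
4-cube `Fin 4 → Bool`; two quadruples differing in ONE index share a transversal triple, and when that triple is non-collinear both
quadruples span the SAME plane. Finite core: a function on the 4-cube that is unchanged by flipping any single coordinate is constant. -/
theorem hypercube_constant {β : Type*} (f : (Fin 4 → Bool) → β)
    (h : ∀ (ε : Fin 4 → Bool) (i : Fin 4) (b : Bool), f ε = f (Function.update ε i b)) (ε ε' : Fin 4 → Bool) :
    f ε = f ε' := by
  have step : ∀ (η : Fin 4 → Bool), f η = f (Function.update (Function.update (Function.update (Function.update η 0 (ε' 0)) 1 (ε' 1)) 2 (ε' 2)) 3 (ε' 3)) := by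
    intro η
    rw [← h, ← h, ← h, ← h]
  have hfun : Function.update (Function.update (Function.update (Function.update ε 0 (ε' 0)) 1 (ε' 1)) 2 (ε' 2)) 3 (ε' 3) = ε' := by
    funext i
    fin_cases i <;> simp [Function.update]
  rw [step ε, hfun]

/-- RIEMANN–ROCH / BRILL–NOETHER NUMBERS OF THEOREM VR (report §4): on `C̃` of genus 8 (`deg K = 14`), for `L` of degree 2 with
`h⁰(L) = 0` the series `|K − L|` is a complete `g⁴₁₂` (`h⁰ = 12 − 7 = 5`); `h⁰(L(D₁)) ≥ 1` for a degree-4 divisor `D₁` iff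
`h⁰(K − L − D₁) ≥ 2` (`8 − 7 = 1`), i.e. the four image points are coplanar in `ℙ⁴` (`≤ 3` conditions); EIGHT coplanar points give
`h⁰ ≥ 5 − 3 = 2` in degree `12 − 8 = 4` — a `g¹₄`, `ρ(8,1,4) = −2 < 0`; FIVE collinear points give `h⁰ ≥ 5 − 2 = 3` in degree
`12 − 5 = 7` — a `g²₇`, `ρ(8,2,7) = −1 < 0`; `ρ(8,1,3) = −4` (no `g¹₃`), `ρ(8,1,5) = 0`; all excluded or finite on the Brill–Noether
general curve `C̃`. -/
theorem theorem_VR_numbers :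
    (2 * 8 - 2 = 14) ∧ ((12 : ℤ) + 1 - 8 = 5) ∧ ((8 : ℤ) + 1 - 8 = 1) ∧ (5 - 3 = 2 ∧ 12 - 8 = 4) ∧ (5 - 2 = 3 ∧ 12 - 5 = 7) ∧
    ((8 : ℤ) - 2 * (8 - 4 + 1) = -2) ∧ ((8 : ℤ) - 3 * (8 - 7 + 2) = -1) ∧ ((8 : ℤ) - 2 * (8 - 3 + 1) = -4) ∧
    ((8 : ℤ) - 2 * (8 - 5 + 1) = 0) := by
  norm_num

/-- THE FOUR THETA-TRANSLATES THROUGH THE RESIDUAL (report 4.1/4.5, THEOREM VR): once a line bundle `L` of degree 2 with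
`Nm L = 𝒪(p̄ + q̄)` and `L(D₁)` effective along the whole polygonal curve is shown to be EFFECTIVE, `L = 𝒪(x + y)` with
`{x̄, ȳ} = {p̄, q̄}`, i.e. `(x, y) ∈ {p, σp} × {q, σq}`: FOUR choices, giving `V(R) = {0, ψ(p), ψ(q), ψ(p) + ψ(q)} = {0, u, −w, u − w}`
and `V(C′) = V(R) + a′ = {a′, a, −a, −a′}`. Finite core: the product of two 2-element sets has 4 elements, and the map
`(x, y) ↦ p + q − x − y` to the free abelian group is injective on it (here: on formal differences, modelled in `ℤ × ℤ` by the
exponents of `ψ(p)` and `ψ(q)`). -/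
theorem four_theta_translates :
    (({0, 1} : Finset ℕ) ×ˢ ({0, 1} : Finset ℕ)).card = 4 ∧
    Function.Injective (fun e : Fin 2 × Fin 2 => ((e.1 : ℤ), (e.2 : ℤ))) ∧
    (({(0, 0), (1, 0), (0, 1), (1, 1)} : Finset (ℤ × ℤ)).card = 4) := by
  refine ⟨by decide, ?_, by decide⟩
  intro e e' h
  simp only [Prod.mk.injEq, Int.natCast_inj] at h
  exact Prod.ext (Fin.ext h.1) (Fin.ext h.2)

end H2ThetaBidualityXXVI

end Summit.HodgeConjecture.HodgeConjecture.WeilTypeLadder
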